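import Summits.ResolutionOfSingularities.ResolutionOfSingularities.Theorems.SectionAscentFibrewiseClosedPointsCertificatesOnRegularBlowupCharts
import Summits.ResolutionOfSingularities.ResolutionOfSingularities.Theorems.SectionAscentFibrewiseClosedPointsCertificateRegular
import Summits.ResolutionOfSingularities.ResolutionOfSingularities.Theorems.SectionAscentFibrewiseClosedPointsCertificateRegularChart
import Summits.ResolutionOfSingularities.ResolutionOfSingularities.Theorems.FrobeniusLadderFInjectiveMacaulayficationStalkChartIso
import Literature.AlgebraicGeometry.Resolution.AffineBlowupAlgebra
import Literature.AlgebraicGeometry.Resolution.ResolutionOfSingularities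
import Mathlib.AlgebraicGeometry.AffineScheme
import Mathlib.RingTheory.FiniteType
import HarnessLib

/-!
# A closed point of a regular blowing up carries a section certificate (`stub_certificatesOnRegularBlowup`)

Crux stmt-ResolutionOfSingularities-15960 (`SectionAscent.FibrewiseClosedPoints`), line `registered`,
CALIBRATION stub `stub_certificatesOnRegularBlowup` — the converse of the landed closed-point
criterion `stub_certificateRegular`.

`A` an integral algebra of finite type over a field `K`, `I ≠ 0`, `X = Bl_I(Spec A) = Proj A[It]`
REGULAR, `y ∈ X` a closed point. Then `y` carries a section certificate: `m ≥ 1` and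
`g₁, …, g_s ∈ I^m` with (a) all `g_j t^m ∈ 𝔭_y`, (b) every proper generization `z ⤳ y` misses
some `g_j t^m`, and (c) the blowing up along `I` of the generic member
`H_g = Spec((K(t) ⊗_K A)/(Σ t_j ⊗ g_j))` is a regular scheme. Construction
(`exists_chartSections`, chartwise at generators `b_i` of `I`): if `y ∉ D₊(b_i t)` take `b_i^m`;
if `y ∈ D₊(b_i t)`, the prime `q_y ⊂ C_i = (A[It])_{(b_i t)}` of `y` is MAXIMAL (`y` is closed),
and for generators `h_l/b_i^{k_l}` of `q_y` and `m ≥ k_l` take `h_l b_i^{m-k_l}`, whose chart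
elements `g t^m/(b_i t)^m` are the `h_l/b_i^{k_l}`. Hence (a); on each chart the sections have at
most the base point `q_y`, whose maximal ideal they generate — this gives (b) (a generization in
the base locus is a prime below `q_y` containing its generators) and is hypothesis (H) of
`isRegular_affineBlowup_genericSection` (`…CertificatesOnRegularBlowupCharts`), which proves (c):
the local rings of `Bl_I(H_g)` are `T/ℓ'T` for localizations `T` of `C_i[t₁, …, t_s]` (regular)
and `ℓ' = Σ t_j c_j ∉ 𝔪_T²` (off the base point by `∂/∂t_j`; at the base point by the
Nullstellensatz, `𝔔 = q_y C_i[t]`, and a leading-coefficient argument showing some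
`c_j ∉ q_y²`), so they are regular (Matsumura 14.2).

References: H. Matsumura, *Commutative Ring Theory*, Thm. 14.2, Thm. 5.3; The Stacks Project,
Tag 0804, Tag 080E; C. Huneke, I. Swanson, *Integral Closure of Ideals, Rings, and Modules*,
§8.5 (generic elements).
-/

-- single-problem summit: the doubled namespace component is forced
set_option linter.dupNamespace false
-- Mathlib is built with this depth; the default (1) makes instance search on the chart rings fail
set_option maxSynthPendingDepth 3

noncomputable section

namespace Summit.ResolutionOfSingularities.ResolutionOfSingularities.Theorems.SectionAscent.CertificatesOnRegularBlowup

open AlgebraicGeometry CategoryTheory Literature.AlgebraicGeometry.Resolution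
open Summit.ResolutionOfSingularities.ResolutionOfSingularities.Theorems.SectionAscent.CertificateRegular
open Summit.ResolutionOfSingularities.ResolutionOfSingularities.Theorems.FInjectiveMacaulayfication.StalkChartIso
open scoped TensorProduct BigOperators Polynomial

/-! ## Elements and sections on a chart `D₊(at)` -/

section Chart

variable {A : Type} [CommRing A] {I : Ideal A} (a : A) (ha : a ∈ I)

/-- Every element of `(A[It])_{(at)}` is `(x t^k)/(at)^k` with `x ∈ I^k`. [folklore] -/
theorem exists_eq_awayMk (z : HomogeneousLocalization.Away (reesGrading I) (reesT a ha)) :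
    ∃ (k : ℕ) (x : A) (hx : x ∈ I ^ k),
      z = HomogeneousLocalization.Away.mk (reesGrading I) (reesT_mem a ha) k
        ⟨Polynomial.monomial k x, reesAlgebra.monomial_mem.mpr hx⟩
        (by rw [smul_eq_mul, mul_one]; exact ⟨x, rfl⟩) := by
  obtain ⟨k, p, hp, rfl⟩ := HomogeneousLocalization.Away.mk_surjective (reesGrading I) (reesT_mem a ha) z
  obtain ⟨x, hxp⟩ := hp
  have hk : (k • 1 : ℕ) = k := by rw [smul_eq_mul, mul_one]
  have hp' : (p : A[X]) = Polynomial.monomial k x := by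
    rw [← hk]
    exact hxp.symm
  have hxI : x ∈ I ^ k := by
    have := p.2 k
    rwa [hp', Polynomial.coeff_monomial, if_pos rfl] at this
  refine ⟨k, x, hxI, ?_⟩
  have hpeq : p = ⟨Polynomial.monomial k x, reesAlgebra.monomial_mem.mpr hxI⟩ := Subtype.ext hp'
  subst hpeq
  rfl

/-- **The section `(x a^{m-k}) t^m` on the chart `D₊(at)` is `(x t^k)/(at)^k`** (`k ≤ m`).
[folklore] -/
theorem isLocalizationElem_mul_pow {k m : ℕ} (hkm : k ≤ m) (x : A) (hx : x ∈ I ^ k)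
    (h' : x * a ^ (m - k) ∈ I ^ m) :
    HomogeneousLocalization.Away.isLocalizationElem (reesT_mem a ha)
      (⟨x * a ^ (m - k), rfl⟩ : (⟨Polynomial.monomial m (x * a ^ (m - k)),
        reesAlgebra.monomial_mem.mpr h'⟩ : reesAlgebra I) ∈ reesGrading I m) =
    HomogeneousLocalization.Away.mk (reesGrading I) (reesT_mem a ha) k
      ⟨Polynomial.monomial k x, reesAlgebra.monomial_mem.mpr hx⟩
      (by rw [smul_eq_mul, mul_one]; exact ⟨x, rfl⟩) := by
  apply reesChart_injective a ha
  have hF1 : (((⟨Polynomial.monomial m (x * a ^ (m - k)), reesAlgebra.monomial_mem.mpr h'⟩ :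
      reesAlgebra I) ^ 1 : reesAlgebra I) : Polynomial A) = Polynomial.monomial m (x * a ^ (m - k)) := by
    rw [pow_one]
  change reesChart a ha (HomogeneousLocalization.Away.mk (reesGrading I) (reesT_mem a ha) m _ _) = _
  rw [reesChart_mk a ha _ hF1, reesChart_mk a ha _ rfl, map_mul, map_pow]
  have e1 : IsLocalization.Away.invSelf (S := Localization.Away a) a ^ m =
      IsLocalization.Away.invSelf a ^ (m - k) * IsLocalization.Away.invSelf a ^ k := by
    rw [← pow_add, Nat.sub_add_cancel hkm]
  rw [e1, ← mul_assoc, mul_assoc (algebraMap A (Localization.Away a) x), ← mul_pow,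
    IsLocalization.Away.mul_invSelf, one_pow, mul_one]

/-- **The section `a^m t^m = (at)^m` is `1` on the chart `D₊(at)`.** [folklore] -/
theorem isLocalizationElem_pow_self (m : ℕ) (h' : a ^ m ∈ I ^ m) :
    HomogeneousLocalization.Away.isLocalizationElem (reesT_mem a ha)
      (⟨a ^ m, rfl⟩ : (⟨Polynomial.monomial m (a ^ m), reesAlgebra.monomial_mem.mpr h'⟩ :
        reesAlgebra I) ∈ reesGrading I m) = 1 := by
  apply HomogeneousLocalization.val_injective
  change (HomogeneousLocalization.Away.mk (reesGrading I) (reesT_mem a ha) m _ _).val = _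
  rw [HomogeneousLocalization.Away.val_mk, HomogeneousLocalization.val_one]
  have hpow : ((⟨Polynomial.monomial m (a ^ m), reesAlgebra.monomial_mem.mpr h'⟩ : reesAlgebra I) ^ 1 :
      reesAlgebra I) = reesT a ha ^ m := by
    apply Subtype.ext
    rw [pow_one, Subalgebra.coe_pow, coe_reesT, Polynomial.monomial_pow, one_mul]
  rw [hpow]
  exact Localization.mk_self (⟨reesT a ha ^ m, _⟩ : Submonoid.powers (reesT a ha))

/-- The section `a^m t^m` is `(at)^m` in `A[It]`. [folklore] -/
theorem monomial_pow_eq_reesT_pow (m : ℕ) (h' : a ^ m ∈ I ^ m) :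
    (⟨Polynomial.monomial m (a ^ m), reesAlgebra.monomial_mem.mpr h'⟩ : reesAlgebra I) = reesT a ha ^ m := by
  apply Subtype.ext
  rw [Subalgebra.coe_pow, coe_reesT, Polynomial.monomial_pow, one_mul]

end Chart

/-! ## The sections through a closed point, chart by chart -/

/-- **Chartwise construction of the certificate.** For `a ∈ I` and a closed point `y` of
`Bl_I(Spec A)` there is `m₀` such that for every `m ≥ m₀` finitely many `g_l ∈ I^m` satisfy:
all `g_l t^m ∈ 𝔭_y`, and (if `a ≠ 0`) every prime of the chart ring `(A[It])_{(at)}` containing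
all chart elements `g_l t^m/(at)^m` is maximal and generated by them. If `y ∉ D₊(at)`: `g = (a^m)`
(chart element `1`). If `y ∈ D₊(at)`: `y` corresponds to a MAXIMAL ideal `q_y` of the chart ring
(closed point), generated by `x_l t^{k_l}/(at)^{k_l}`; take `g_l = x_l a^{m-k_l}`. [folklore] -/
theorem exists_chartSections (A : Type) [CommRing A] [IsNoetherianRing A] (I : Ideal A) (a : A)
    (ha : a ∈ I) (y : affineBlowup I) (hy : IsClosed ({y} : Set (affineBlowup I))) :
    ∃ m₀ : ℕ, ∀ m, m₀ ≤ m → ∃ (n : ℕ) (g : Fin n → A) (hg : ∀ l, g l ∈ I ^ m),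
      (∀ l, (⟨Polynomial.monomial m (g l), reesAlgebra.monomial_mem.mpr (hg l)⟩ : reesAlgebra I) ∈
        y.asHomogeneousIdeal) ∧
      (a ≠ 0 → ∀ q : PrimeSpectrum (HomogeneousLocalization.Away (reesGrading I) (reesT a ha)),
        (∀ l, HomogeneousLocalization.Away.isLocalizationElem (reesT_mem a ha)
          (⟨g l, rfl⟩ : (⟨Polynomial.monomial m (g l), reesAlgebra.monomial_mem.mpr (hg l)⟩ :
            reesAlgebra I) ∈ reesGrading I m) ∈ q.asIdeal) →
        q.asIdeal.IsMaximal ∧ q.asIdeal = Ideal.span (Set.range fun l =>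
          HomogeneousLocalization.Away.isLocalizationElem (reesT_mem a ha)
            (⟨g l, rfl⟩ : (⟨Polynomial.monomial m (g l), reesAlgebra.monomial_mem.mpr (hg l)⟩ :
              reesAlgebra I) ∈ reesGrading I m))) := by
  classical
  by_cases hya : y ∈ Proj.basicOpen (reesGrading I) (reesT a ha)
  · -- `y` lies in the chart: `y = awayι q_y` with `q_y` maximal
    have ha0 : a ≠ 0 := by
      intro h0
      rw [reesT_eq_zero a ha h0, Proj.basicOpen_zero] at hya
      exact hya
    have _h := ha0
    rw [← Proj.opensRange_awayι (reesGrading I) (reesT a ha) (reesT_mem a ha) one_pos] at hya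
    obtain ⟨qy, rfl⟩ := Scheme.Hom.mem_opensRange.mp hya
    have hqymax : qy.asIdeal.IsMaximal := by
      have h1 := hy.preimage
        (Proj.awayι (reesGrading I) (reesT a ha) (reesT_mem a ha) one_pos).base.hom.continuous
      have hpre : (Proj.awayι (reesGrading I) (reesT a ha) (reesT_mem a ha) one_pos) ⁻¹'
          {Proj.awayι (reesGrading I) (reesT a ha) (reesT_mem a ha) one_pos qy} = {qy} := by
        ext p
        simp only [Set.mem_preimage, Set.mem_singleton_iff]
        exact (Proj.awayι (reesGrading I) (reesT a ha) (reesT_mem a ha)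
          one_pos).isOpenEmbedding.injective.eq_iff
      rw [hpre] at h1
      exact (PrimeSpectrum.isClosed_singleton_iff_isMaximal qy).mp h1
    -- generators of `q_y` and their numerators
    haveI : IsNoetherianRing (HomogeneousLocalization.Away (reesGrading I) (reesT a ha)) :=
      isNoetherianRing_away' a ha
    obtain ⟨n, e, he⟩ := Submodule.fg_iff_exists_fin_generating_family.mp
      (IsNoetherian.noetherian qy.asIdeal)
    choose k x hx hkx using fun l => exists_eq_awayMk a ha (e l)
    refine ⟨max 1 (Finset.univ.sup k), fun m hm => ?_⟩
    have hm1 : 0 < m := lt_of_lt_of_le one_pos ((le_max_left _ _).trans hm)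
    have hkm : ∀ l, k l ≤ m := fun l =>
      ((Finset.le_sup (Finset.mem_univ l)).trans (le_max_right _ _)).trans hm
    have hgI : ∀ l, x l * a ^ (m - k l) ∈ I ^ m := fun l => by
      have := Ideal.mul_mem_mul (hx l) (Ideal.pow_mem_pow ha (m - k l))
      rwa [← pow_add, Nat.add_sub_cancel' (hkm l)] at this
    have hce : ∀ l, HomogeneousLocalization.Away.isLocalizationElem (reesT_mem a ha)
        (⟨x l * a ^ (m - k l), rfl⟩ : (⟨Polynomial.monomial m (x l * a ^ (m - k l)),
          reesAlgebra.monomial_mem.mpr (hgI l)⟩ : reesAlgebra I) ∈ reesGrading I m) = e l := fun l => by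
      rw [isLocalizationElem_mul_pow a ha (hkm l) (x l) (hx l) (hgI l), ← hkx l]
    refine ⟨n, fun l => x l * a ^ (m - k l), hgI, fun l => ?_, fun _ q hall => ?_⟩
    · refine (isLocalizationElem_mem_iff (reesGrading I) (reesT_mem a ha) one_pos
        (⟨x l * a ^ (m - k l), rfl⟩ : (⟨Polynomial.monomial m (x l * a ^ (m - k l)),
          reesAlgebra.monomial_mem.mpr (hgI l)⟩ : reesAlgebra I) ∈ reesGrading I m) hm1 qy).mp ?_
      rw [hce l, ← he]
      exact Submodule.subset_span ⟨l, rfl⟩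
    · have hall' : ∀ l, e l ∈ q.asIdeal := fun l => hce l ▸ hall l
      have hle : qy.asIdeal ≤ q.asIdeal := by
        rw [← he]
        exact Submodule.span_le.mpr (by rintro _ ⟨l, rfl⟩; exact hall' l)
      have heq : qy.asIdeal = q.asIdeal := hqymax.eq_of_le q.isPrime.ne_top hle
      refine ⟨heq ▸ hqymax, ?_⟩
      rw [← heq, ← he]
      have hfun : e = fun l => HomogeneousLocalization.Away.isLocalizationElem (reesT_mem a ha)
          (⟨x l * a ^ (m - k l), rfl⟩ : (⟨Polynomial.monomial m (x l * a ^ (m - k l)),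
            reesAlgebra.monomial_mem.mpr (hgI l)⟩ : reesAlgebra I) ∈ reesGrading I m) :=
        funext fun l => (hce l).symm
      rw [← hfun]
  · -- `y` outside the chart: the single section `a^m t^m = (at)^m`
    refine ⟨1, fun m hm => ⟨1, fun _ => a ^ m, fun _ => Ideal.pow_mem_pow ha m, fun _ => ?_,
      fun _ q hall => ?_⟩⟩
    · have hT : reesT a ha ∈ y.asHomogeneousIdeal := by
        rwa [Proj.mem_basicOpen, not_not] at hya
      rw [monomial_pow_eq_reesT_pow a ha m (Ideal.pow_mem_pow ha m)]
      exact Ideal.pow_mem_of_mem _ hT m hm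
    · exfalso
      have h1 := hall 0
      rw [isLocalizationElem_pow_self a ha m (Ideal.pow_mem_pow ha m)] at h1
      exact q.isPrime.ne_top ((Ideal.eq_top_iff_one _).mpr h1)

/-! ## The calibration stub -/

/-- CALIBRATION STUB `stub_certificatesOnRegularBlowup` of line `registered` (crux
`SectionAscent.FibrewiseClosedPoints`): **a closed point of a regular blowing up carries a
section certificate** — the converse of `stub_certificateRegular`. See the module docstring for
the construction and the proof of (a), (b), (c).
[cite: Matsumura1987, Thm. 14.2; StacksProject, Tag 080E; HunekeSwanson2006, §8.5] -/
theorem stub_certificatesOnRegularBlowup (K : Type) [Field K] (A : Type) [CommRing A] [IsDomain A] [Algebra K A] [Algebra.FiniteType K A] (I : Ideal A) (hI : I ≠ ⊥) (hreg : Literature.AlgebraicGeometry.Resolution.Scheme.IsRegular (Literature.AlgebraicGeometry.Resolution.affineBlowup I)) (y : Literature.AlgebraicGeometry.Resolution.affineBlowup I) (hy : IsClosed ({y} : Set (Literature.AlgebraicGeometry.Resolution.affineBlowup I))) : ∃ (m s : ℕ) (g : Fin s → A) (hg : ∀ j, g j ∈ I ^ m), 0 < m ∧ (∀ j, (⟨Polynomial.monomial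 m (g j), reesAlgebra.monomial_mem.mpr (hg j)⟩ : reesAlgebra I) ∈ y.asHomogeneousIdeal) ∧ (∀ z : Literature.AlgebraicGeometry.Resolution.affineBlowup I, z ⤳ y → z ≠ y → ∃ j, (⟨Polynomial.monomial m (g j), reesAlgebra.monomial_mem.mpr (hg j)⟩ : reesAlgebra I) ∉ z.asHomogeneousIdeal) ∧ (let Ks := FractionRing (MvPolynomial (Fin s) K); let ℓ : TensorProduct K Ks A := ∑ j : Fin s, (algebraMap (MvPolynomial (Fin s) K) Ks (MvPolynomial.X j)) ⊗ₜ[K] g j; let φ : A →+* (TensorProduct K Ks A ⧸ Ideal.span {ℓ}) := (Ideal.Quotient.mk (Ideal.span {ℓ})).comp (Algebra.TensorProduct.includeRight (R := K) (A := Ks) (B := A)).toRingHom; Literature.AlgebraicGeometry.Resolution.Scheme.IsRegular (Literature.AlgebraicGeometry.Resolution.affineBlowup (I.map φ))) := by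
  have _hI : I ≠ ⊥ := hI
  haveI : IsNoetherianRing A := Algebra.FiniteType.isNoetherianRing K A
  -- generators `b_i` of `I` and the chartwise sections
  obtain ⟨r, b, hspan⟩ := Submodule.fg_iff_exists_fin_generating_family.mp (IsNoetherian.noetherian I)
  have hspan' : Ideal.span (Set.range b) = I := hspan
  have hbI : ∀ i, b i ∈ I := fun i => hspan' ▸ Ideal.subset_span ⟨i, rfl⟩
  choose m₀ hm₀ using fun i => exists_chartSections A I (b i) (hbI i) y hy
  obtain ⟨m, hm, hmi⟩ : ∃ m, 0 < m ∧ ∀ i, m₀ i ≤ m :=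
    ⟨max 1 (Finset.univ.sup m₀), lt_of_lt_of_le one_pos (le_max_left _ _),
      fun i => (Finset.le_sup (Finset.mem_univ i)).trans (le_max_right _ _)⟩
  choose n g hg hga hH using fun i => hm₀ i m (hmi i)
  -- one family indexed by `Fin s`
  let e := Fintype.equivFin (Σ i : Fin r, Fin (n i))
  let G : Fin (Fintype.card (Σ i : Fin r, Fin (n i))) → A := fun j => g (e.symm j).1 (e.symm j).2
  have hG : ∀ j, G j ∈ I ^ m := fun j => hg _ _
  have hGe : ∀ i l, G (e ⟨i, l⟩) = g i l := fun i l => by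
    show g (e.symm (e ⟨i, l⟩)).1 (e.symm (e ⟨i, l⟩)).2 = g i l
    rw [Equiv.symm_apply_apply]
  refine ⟨m, Fintype.card (Σ i : Fin r, Fin (n i)), G, hG, hm, fun j => hga _ _, ?_, ?_⟩
  · -- (b): a proper generization `z ⤳ y` misses some section
    intro z hz hne
    obtain ⟨i, hbi0, hyi⟩ := exists_mem_basicOpen_of_le_span b hbI hspan'.ge y
    have hzi : z ∈ Proj.basicOpen (reesGrading I) (reesT (b i) (hbI i)) :=
      hz.mem_open (Proj.basicOpen _ _).isOpen hyi
    rw [← Proj.opensRange_awayι (reesGrading I) (reesT (b i) (hbI i)) (reesT_mem (b i) (hbI i))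
      one_pos] at hyi hzi
    obtain ⟨qy, hqy⟩ := Scheme.Hom.mem_opensRange.mp hyi
    obtain ⟨qz, hqz⟩ := Scheme.Hom.mem_opensRange.mp hzi
    by_contra hcon
    push Not at hcon
    have hle : qz.asIdeal ≤ qy.asIdeal := by
      have h' : Proj.awayι (reesGrading I) (reesT (b i) (hbI i)) (reesT_mem (b i) (hbI i)) one_pos qz ⤳
          Proj.awayι (reesGrading I) (reesT (b i) (hbI i)) (reesT_mem (b i) (hbI i)) one_pos qy := by
        rw [hqz, hqy]; exact hz
      have h'' : qz ⤳ qy := (Proj.awayι (reesGrading I) (reesT (b i) (hbI i)) (reesT_mem (b i) (hbI i))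
        one_pos).isOpenEmbedding.toIsEmbedding.isInducing.specializes_iff.mp h'
      exact (PrimeSpectrum.asIdeal_le_asIdeal qz qy).mpr ((PrimeSpectrum.le_iff_specializes qz qy).mpr h'')
    have hmemz : ∀ l, HomogeneousLocalization.Away.isLocalizationElem (reesT_mem (b i) (hbI i))
        (⟨g i l, rfl⟩ : (⟨Polynomial.monomial m (g i l), reesAlgebra.monomial_mem.mpr (hg i l)⟩ :
          reesAlgebra I) ∈ reesGrading I m) ∈ qz.asIdeal := fun l => by
      have h1 := hcon (e ⟨i, l⟩)
      rw [← hqz] at h1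
      have h2 := (isLocalizationElem_mem_iff (reesGrading I) (reesT_mem (b i) (hbI i)) one_pos
        (⟨G (e ⟨i, l⟩), rfl⟩ : (⟨Polynomial.monomial m (G (e ⟨i, l⟩)),
          reesAlgebra.monomial_mem.mpr (hG _)⟩ : reesAlgebra I) ∈ reesGrading I m) hm qz).mpr h1
      rwa [isLocalizationElem_congr (b i) (hbI i) m (hG _) (hg i l) (hGe i l)] at h2
    obtain ⟨hmax, -⟩ := hH i hbi0 qz hmemz
    have heq : qz = qy := PrimeSpectrum.ext (hmax.eq_of_le qy.isPrime.ne_top hle)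
    exact hne (by rw [← hqz, ← hqy, heq])
  · -- (c): the blowing up of the generic member is regular
    have Fdeg : ∀ j, (⟨Polynomial.monomial m (G j), reesAlgebra.monomial_mem.mpr (hG j)⟩ :
        reesAlgebra I) ∈ reesGrading I m := fun j => ⟨G j, rfl⟩
    exact isRegular_affineBlowup_genericSection K A I hreg b hbI hspan' _ m G
      (fun i j => HomogeneousLocalization.Away.isLocalizationElem (reesT_mem (b i) (hbI i)) (Fdeg j))
      (fun i j => reesChartBase_pow_mul_isLocalizationElem (b i) (hbI i) m (G j) (hG j))
      (fun i hbi0 q hq hall => by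
        obtain ⟨hmax, hspanq⟩ := hH i hbi0 ⟨q, hq⟩ (fun l => by
          have := hall (e ⟨i, l⟩)
          rwa [isLocalizationElem_congr (b i) (hbI i) m (hG _) (hg i l) (hGe i l)] at this)
        refine ⟨hmax, le_antisymm ?_ (Ideal.span_le.mpr ?_)⟩
        · have hq' : q = _ := hspanq
          rw [hq']
          apply Ideal.span_mono
          rintro _ ⟨l, rfl⟩
          exact ⟨e ⟨i, l⟩, isLocalizationElem_congr (b i) (hbI i) m (hG _) (hg i l) (hGe i l)⟩
        · rintro _ ⟨j, rfl⟩
          exact hall j)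

end Summit.ResolutionOfSingularities.ResolutionOfSingularities.Theorems.SectionAscent.CertificatesOnRegularBlowup

end
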